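import Summits.ResolutionOfSingularities.ResolutionOfSingularities.Theorems.PAlterationPicoverOfDegP
import HarnessLib

/-!
# Stub `stub_picoverOver_of_degP` (crux stmt-ResolutionOfSingularities-0552, line `Sketch` rev c2)

Fieldwise form of `Picover ⟸ DegP`: for ONE field `K` of characteristic `p` (no perfectness
needed), the degree-`p` residue `DegP_K` (normalisations of regular integral separated finite-type
`W/K` in degree-`p` purely inseparable extensions `L/K(W)` are resolvable) implies PICover over
`K` (every integral `X` finite, universally injective and surjective over a regular integral
separated finite-type `Y/K` has a resolution).

The proof is the landed `Picover.OfDegP.picover_of_picoverDegP` read at a single field: `g` is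
dominant, `K(X)/K(Y)` along `g` is finite purely inseparable (`stub_functionFieldRadicial`) of
degree `p ^ n` (`IsPurelyInseparable.finrank_eq_pow`); the tower induction
`hasResolution_normalizationIn_of_finrank_eq_pow` resolves `Y^{K(X)}`; the finite birational
comparison `Y^{K(X)} → X` transfers the resolution to `X` (`stub_ofNormalizationIn`, fed with the
function-field identification `stub_functionField_normalizationIn`).
-/

set_option linter.dupNamespace false

noncomputable section

open CategoryTheory AlgebraicGeometry TopologicalSpace
open Literature.AlgebraicGeometry.Resolution Literature.AlgebraicGeometry.Motives

namespace Summit.ResolutionOfSingularities.ResolutionOfSingularities.Theorems.PalterationThesis.PerfectQuotient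

/-- **Fieldwise `Picover ⟸ DegP`.** Over a field `K` of characteristic `p`, if the normalisation
of every regular integral separated finite-type `K`-scheme `W` in every purely inseparable
extension `L/K(W)` of degree `p` has a resolution, then every integral `X` admitting a finite,
universally injective, surjective morphism `g : X ⟶ Y` onto a regular integral separated
finite-type `K`-scheme `Y` has a resolution. [cite: Temkin2013, Rem. 1.3.5 (ii)-(iii)] -/
theorem stub_picoverOver_of_degP (p : ℕ) (hp : p.Prime) (K : Type) [Field K] [CharP K p]
    (hDegP : ∀ (W : Scheme.{0}) [IsIntegral W] (f : W ⟶ Spec (.of K)) (L : Type) [Field L]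
      [Algebra W.functionField L], IsSeparated f → LocallyOfFiniteType f → QuasiCompact f →
      Scheme.IsRegular W → IsPurelyInseparable W.functionField L →
      Module.finrank W.functionField L = p → Scheme.HasResolution (normalizationIn W L)) :
    ∀ (Y X : Scheme.{0}) (f : Y ⟶ Spec (.of K)) (g : X ⟶ Y),
      IsSeparated f → LocallyOfFiniteType f → QuasiCompact f → IsIntegral Y →
      Scheme.IsRegular Y → IsIntegral X → IsFinite g → UniversallyInjective g →
      Function.Surjective g.base → Scheme.HasResolution X := by
  intro Y X f g _hsep _hlft _hqc _hY hYreg _hX _hfin _hui hsurj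
  haveI : Fact p.Prime := ⟨hp⟩
  haveI : IsDominant g := ⟨hsurj.denseRange⟩
  haveI : CharP Y.functionField p := Picover.TowerTransport.charP_functionField Y f
  haveI : ExpChar Y.functionField p := ExpChar.prime hp
  haveI : IsPurelyInseparable Y.functionField (FunctionFieldOver g) :=
    Picover.FunctionFieldRadicial.stub_functionFieldRadicial X Y g
  obtain ⟨n, hn⟩ := IsPurelyInseparable.finrank_eq_pow Y.functionField (FunctionFieldOver g) p
  have hN : Scheme.HasResolution (normalizationIn Y (FunctionFieldOver g)) :=
    Picover.OfDegP.hasResolution_normalizationIn_of_finrank_eq_pow hDegP Y f hYreg n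
      (FunctionFieldOver g) hn
  exact Picover.OfNormalizationIn.stub_ofNormalizationIn K X Y f g
    (Picover.FunctionFieldNormalizationIn.stub_functionField_normalizationIn Y
      (FunctionFieldOver g)) hN

end Summit.ResolutionOfSingularities.ResolutionOfSingularities.Theorems.PalterationThesis.PerfectQuotient

end
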